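import Mathlib.MeasureTheory.Measure.GiryMonad
import Mathlib.MeasureTheory.Measure.Count
import Mathlib.MeasureTheory.Measure.Dirac
import Mathlib.MeasureTheory.Integral.Lebesgue.Countable
import Mathlib.MeasureTheory.Integral.Lebesgue.Map
import Mathlib.MeasureTheory.Group.Arithmetic
import Mathlib.Topology.MetricSpace.IsometricSMul
import Mathlib.MeasureTheory.Group.MeasurableEquiv
import HarnessLib

/-!
# Point-stationary laws of rooted configurations (Mecke / mass-transport identity) and rooted
hard-core configurations

A *rooted configuration* in a (measurable, additive) group `G` is encoded as a measure
`μ : Measure G` — typically a counting measure `count.restrict S` of a point set `S ∋ 0`, the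
root sitting at the origin — and a *law of rooted configurations* as a measure
`P : Measure (Measure G)` (Giry σ-algebra `MeasureTheory.Measure.instMeasurableSpace`).
Re-rooting `μ` at one of its points `y` is the shift `θ_y μ := μ(· + y) = μ.map (· - y)`, which
moves `y` to the origin and the old root to `-y` (`θ_y δ_y = δ_0`, [LastPenrose2017, (8.1)]).

* `IsPointStationaryLaw P` — the **Mecke / mass-transport identity**
  `∫ Σ_{y ∈ μ} g(μ, y) P(dμ) = ∫ Σ_{y ∈ μ} g(θ_y μ, −y) P(dμ)` for every jointly measurable
  `g : Measure G → G → ℝ≥0∞` (sums written as `∫⁻ y, · ∂μ`): the Campbell measure `μ(dy) P(dμ)`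
  is invariant under the involution `(μ, y) ↦ (θ_y μ, −y)`. By Mecke's intrinsic characterisation
  [Mecke1967, Satz 2.5] (restated as [HevelingLast2007, §4 (4.3)]) a σ-finite measure `Q` on
  locally finite configurations not charging the zero measure is the PALM MEASURE of a stationary
  measure iff it satisfies this identity; for simple point processes on `ℝᵈ` with a point at `0`
  the identity is equivalent to Thorisson's POINT-STATIONARITY (distributional invariance under all
  bijective point-shifts) [HevelingLast2005] ([HevelingLast2007, Thm 1.1] on Abelian groups), and to
  MASS-STATIONARITY [LastThorisson2009]; it is the point-process form of the Aldous–Lyons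
  Mass-Transport Principle defining UNIMODULAR random rooted networks [AldousLyons2007, §2].
  We take the integral identity itself as the definition (no intensity, σ-finiteness, simplicity
  or "`0 ∈ supp μ`" requirement is built in; those are separate hypotheses of the users).
* `IsRootedHardCore δ μ` — `μ` is the counting measure of a `δ`-separated point set containing the
  root `0` (hard-core rooted configuration).

## API (all proved)
* `isPointStationaryLaw_iff`; closure under mixtures: `IsPointStationaryLaw.zero`, `.add`, `.smul`,
  `.sum` (the point-stationary laws form a convex cone closed under countable sums);
* `IsPointStationaryLaw.of_ae_invariant` — a law carried by configurations that are invariant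
  under the shifts by (almost all of) their own points and under `y ↦ -y` (lattices `count|L`,
  `L` a subgroup; Haar measure) is point-stationary;
* `isPointStationaryLaw_dirac_dirac_zero` — the one-point configuration `δ_{δ_0}` is
  point-stationary (non-vacuity witness; it is also `IsRootedHardCore δ` for every `δ`,
  `isRootedHardCore_dirac_zero`); `measurableSet_setOf_eq_dirac_zero`, `ae_dirac_dirac_zero`
  (the Giry σ-algebra separates `δ_0`, so `δ_{δ_0}`-a.e. configuration is `δ_0`);
* `isPointStationaryLaw_dirac_count` — for a countable group (the lattice `ℤᵈ`) the full
  configuration `count` rooted at `0` has a point-stationary law (`measurableSet_setOf_eq_count`);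
* `IsRootedHardCore.mono`, `IsRootedHardCore.measure_zero_singleton` (the root carries mass `1`),
  `isRootedHardCore_iff_pairwise`;
* re-rooting: `map_sub_count_restrict` (`(count|S).map (· - y) = count|((· - y) '' S)`),
  `count_restrict_singleton_ne_zero_iff` (`y` is a point of `count|S` iff `y ∈ S`) and
  `IsRootedHardCore.map_sub` (re-rooting a hard-core configuration at one of its points gives a
  hard-core configuration — translations are isometries).

## Design notes
* Generality: `G` is any measurable additive group (the sources: locally compact second countable
  Abelian groups [Mecke1967, HevelingLast2007]; the requesting route: `EuclideanSpace ℝ (Fin 3)`).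
  The identity only uses `z - y` and `-y`; `(μ, y) ↦ (μ.map (· - y), -y)` is an involution in any
  additive group.
* The shift is written `MeasureTheory.Measure.map (fun z => z - y) μ` and the separation as
  `∀ x ∈ S, ∀ y ∈ S, x ≠ y → δ ≤ dist x y`, literally as inlined in the signatures of route
  `AtomisticToContinuum/Crystallization/PalmUnimodular*` so that those items restate by folding.
* No sign hypothesis on `δ` (for `δ ≤ 0` the separation clause is vacuous and `S` is any set
  containing `0`; callers assume `0 < δ`).
* NOT here: Palm measures of stationary point processes (refined Campbell theorem), the
  equivalence with bijective point-shift invariance, the local (vague) topology on configurations,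
  and the "root a.s. ⇒ every point a.s." transfer — these need the locally finite carrier space
  and are requests/items of their own.

## References
* J. Mecke, *Stationäre zufällige Maße auf lokalkompakten Abelschen Gruppen*, Z. Wahrsch. verw.
  Geb. 9 (1967) 36–58, Satz 2.3–2.5. [Mecke1967]
* M. Heveling, G. Last, *Characterization of Palm measures via bijective point-shifts*, Ann.
  Probab. 33 (2005) 1698–1715. [HevelingLast2005]
* M. Heveling, G. Last, *Point shift characterization of Palm measures on Abelian groups*,
  Electron. J. Probab. 12 (2007) 122–137, Thm 1.1, §4. [HevelingLast2007]
* G. Last, H. Thorisson, *Invariant transports of stationary random measures and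
  mass-stationarity*, Ann. Probab. 37 (2009). [LastThorisson2009]
* D. Aldous, R. Lyons, *Processes on unimodular random networks*, EJP 12 (2007), §2
  (Mass-Transport Principle). [AldousLyons2007]
* G. Last, M. Penrose, *Lectures on the Poisson Process*, CUP 2017, (8.1) and Ch. 9.
  [LastPenrose2017]
-/

noncomputable section

open scoped ENNReal
open _root_.MeasureTheory _root_.MeasureTheory.Measure Set

namespace Literature.Probability.Process

/-! ### The one-point configuration `δ_0` in the Giry σ-algebra -/

section DiracZero

variable {G : Type*} [MeasurableSpace G] [Zero G]

/-- The set of configurations equal to `δ_0` is measurable in the Giry σ-algebra: it is cut out by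
the two evaluations `μ {0}ᶜ = 0` and `μ univ = 1`. [folklore] -/
theorem measurableSet_setOf_eq_dirac_zero (h0 : MeasurableSet ({0} : Set G)) :
    MeasurableSet {μ : Measure G | μ = Measure.dirac 0} := by
  have hrepr : {μ : Measure G | μ = Measure.dirac 0} =
      {μ : Measure G | μ ({0} : Set G)ᶜ = 0} ∩ {μ : Measure G | μ univ = 1} := by
    ext μ
    simp only [mem_setOf_eq, mem_inter_iff]
    constructor
    · rintro rfl
      refine ⟨?_, ?_⟩
      · rw [Measure.dirac_apply' _ h0.compl]
        simp
      · exact measure_univ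
    · rintro ⟨hc, hu⟩
      ext s hs
      rw [Measure.dirac_apply' _ hs]
      by_cases h0s : (0 : G) ∈ s
      · rw [indicator_of_mem h0s, Pi.one_apply]
        have hsc : μ sᶜ = 0 :=
          measure_mono_null (compl_subset_compl.2 (singleton_subset_iff.2 h0s)) hc
        have := measure_add_measure_compl (μ := μ) hs
        rw [hsc, add_zero, hu] at this
        exact this
      · rw [indicator_of_notMem h0s]
        exact measure_mono_null (fun x hx => by rintro rfl; exact h0s hx) hc
  rw [hrepr]
  exact ((Measure.measurable_coe h0.compl) (measurableSet_singleton 0)).inter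
    ((Measure.measurable_coe MeasurableSet.univ) (measurableSet_singleton 1))

/-- Under the law `δ_{δ_0}` almost every configuration IS `δ_0` (the Giry σ-algebra separates
`δ_0`, `measurableSet_setOf_eq_dirac_zero`), so every property of `δ_0` holds almost surely.
[folklore] -/
theorem ae_dirac_dirac_zero (h0 : MeasurableSet ({0} : Set G)) :
    ∀ᵐ μ ∂(Measure.dirac (Measure.dirac (0 : G)) : Measure (Measure G)), μ = Measure.dirac 0 := by
  rw [ae_iff]
  have h : {μ : Measure G | ¬μ = Measure.dirac 0} = {μ : Measure G | μ = Measure.dirac 0}ᶜ := rfl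
  rw [h, Measure.dirac_apply' _ (measurableSet_setOf_eq_dirac_zero h0).compl]
  simp

end DiracZero

section Count

variable {G : Type*} [MeasurableSpace G]

/-- The set `{count}` is measurable in the Giry σ-algebra of a countable space with measurable
singletons: it is cut out by the countably many evaluations `μ {a} = 1`. [folklore] -/
theorem measurableSet_setOf_eq_count [Countable G] [MeasurableSingletonClass G] :
    MeasurableSet {μ : Measure G | μ = Measure.count} := by
  have hrepr : {μ : Measure G | μ = Measure.count} = ⋂ a : G, {μ : Measure G | μ {a} = 1} := by
    ext μ
    simp only [mem_setOf_eq, mem_iInter]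
    constructor
    · rintro rfl a
      exact Measure.count_singleton a
    · intro h
      exact Measure.ext_of_singleton fun a => by rw [h a, Measure.count_singleton]
  rw [hrepr]
  exact MeasurableSet.iInter fun a =>
    (Measure.measurable_coe (measurableSet_singleton a)) (measurableSet_singleton 1)

end Count

/-! ### Point-stationary (Palm-type) laws -/

section PointStationary

variable {G : Type*} [MeasurableSpace G] [AddGroup G]

/-- **Point-stationary law** (Mecke / mass-transport identity). A measure `P` on configurations
`μ : Measure G` (think: counting measures of point sets containing the root `0`) is
*point-stationary* if for every jointly measurable `g : Measure G → G → ℝ≥0∞`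
`∫⁻ μ, ∫⁻ y, g μ y ∂μ ∂P = ∫⁻ μ, ∫⁻ y, g (θ_y μ) (-y) ∂μ ∂P`, where `θ_y μ = μ.map (· - y)`
re-roots the configuration at its point `y` (the old root becomes `-y`): "mass sent out of the
root equals mass received at the root". This is the integral equation of Mecke's intrinsic
characterisation of Palm measures [cite: Mecke1967, Satz 2.5], equivalently invariance of the
Campbell measure `μ(dy)P(dμ)` under the involution `(μ, y) ↦ (θ_y μ, -y)`
[cite: HevelingLast2007, §4 (4.3) and Thm 1.1]; for simple point processes on `ℝᵈ` rooted at `0`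
it is Thorisson's point-stationarity (Heveling–Last 2005) and the Aldous–Lyons mass-transport
principle. No normalisation or carrier hypothesis on `P` is built in. -/
def IsPointStationaryLaw (P : Measure (Measure G)) : Prop :=
  ∀ g : Measure G → G → ℝ≥0∞, Measurable (Function.uncurry g) →
    ∫⁻ μ, ∫⁻ y, g μ y ∂μ ∂P = ∫⁻ μ, ∫⁻ y, g (Measure.map (fun z => z - y) μ) (-y) ∂μ ∂P

/-- Unfolding `IsPointStationaryLaw` to the Mecke identity as inlined by its users. [folklore] -/
theorem isPointStationaryLaw_iff (P : Measure (Measure G)) :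
    IsPointStationaryLaw P ↔ ∀ g : Measure G → G → ℝ≥0∞, Measurable (Function.uncurry g) →
      ∫⁻ μ, ∫⁻ y, g μ y ∂μ ∂P = ∫⁻ μ, ∫⁻ y, g (Measure.map (fun z => z - y) μ) (-y) ∂μ ∂P :=
  Iff.rfl

/-- The zero measure is (vacuously) point-stationary. [folklore] -/
theorem IsPointStationaryLaw.zero : IsPointStationaryLaw (0 : Measure (Measure G)) := by
  intro g _
  simp only [lintegral_zero_measure]

/-- Point-stationary laws are closed under addition (mixtures). [folklore] -/
theorem IsPointStationaryLaw.add {P Q : Measure (Measure G)} (hP : IsPointStationaryLaw P)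
    (hQ : IsPointStationaryLaw Q) : IsPointStationaryLaw (P + Q) := by
  intro g hg
  simp only [lintegral_add_measure, hP g hg, hQ g hg]

/-- Point-stationary laws are closed under scaling. [folklore] -/
theorem IsPointStationaryLaw.smul {P : Measure (Measure G)} (c : ℝ≥0∞)
    (hP : IsPointStationaryLaw P) : IsPointStationaryLaw (c • P) := by
  intro g hg
  simp only [lintegral_smul_measure, hP g hg]

/-- Point-stationary laws are closed under countable sums (σ-convexity of the cone of
point-stationary laws). [folklore] -/
theorem IsPointStationaryLaw.sum {ι : Type*} [Countable ι] {P : ι → Measure (Measure G)}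
    (hP : ∀ i, IsPointStationaryLaw (P i)) : IsPointStationaryLaw (Measure.sum P) := by
  intro g hg
  simp only [lintegral_sum_measure, hP _ g hg]

/-- **Self-invariant configurations give point-stationary laws.** If `P`-almost every
configuration `μ` is invariant under the shift by `μ`-almost each of its own points
(`μ.map (· - y) = μ`) and under the reflection `y ↦ -y`, then `P` is point-stationary: the inner
integral `∫⁻ y, g (θ_y μ) (-y) ∂μ` equals `∫⁻ y, g μ (-y) ∂μ = ∫⁻ y, g μ y ∂μ`. Examples: the Dirac
mass at the counting measure of an additive subgroup (a lattice rooted at `0`), or at a Haar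
measure. [folklore] -/
theorem IsPointStationaryLaw.of_ae_invariant [MeasurableNeg G] {P : Measure (Measure G)}
    (h : ∀ᵐ μ ∂P, (∀ᵐ y ∂μ, Measure.map (fun z => z - y) μ = μ) ∧
      Measure.map (fun y : G => -y) μ = μ) :
    IsPointStationaryLaw P := by
  intro g hg
  refine lintegral_congr_ae (h.mono fun μ hμ => ?_)
  obtain ⟨hshift, hneg⟩ := hμ
  have hgμ : Measurable (g μ) := hg.comp measurable_prodMk_left
  calc ∫⁻ y, g μ y ∂μ = ∫⁻ y, g μ y ∂(Measure.map (fun y : G => -y) μ) := by rw [hneg]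
    _ = ∫⁻ y, g μ (-y) ∂μ := lintegral_map hgμ measurable_neg
    _ = ∫⁻ y, g (Measure.map (fun z => z - y) μ) (-y) ∂μ :=
        lintegral_congr_ae (hshift.mono fun y hy => by simp only [hy])

/-- **The one-point configuration is point-stationary**: the law `δ_{δ_0}` of the configuration
consisting of the root alone satisfies the Mecke identity (both sides equal `g δ_0 0`).
Non-vacuity witness for `IsPointStationaryLaw`. [folklore] -/
theorem isPointStationaryLaw_dirac_dirac_zero [MeasurableSingletonClass G] [MeasurableNeg G] :
    IsPointStationaryLaw (Measure.dirac (Measure.dirac (0 : G)) : Measure (Measure G)) := by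
  refine IsPointStationaryLaw.of_ae_invariant ?_
  refine (ae_dirac_dirac_zero (measurableSet_singleton (0 : G))).mono fun μ hμ => ?_
  subst hμ
  refine ⟨?_, ?_⟩
  · rw [ae_dirac_eq]
    simp
  · rw [map_dirac' measurable_neg, neg_zero]

/-- **The full countable group is point-stationary**: for a countable measurable group `G`
(e.g. the lattice `ℤᵈ`), the deterministic configuration `count` (every group element is a
point, rooted at `0`) has a point-stationary law `δ_{count}` — `count` is invariant under every
shift `z ↦ z - y` and under `z ↦ -z`. This is the Palm version of the stationary lattice
`ℤᵈ + U`, `U` uniform in a fundamental cell. [folklore] -/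
theorem isPointStationaryLaw_dirac_count [Countable G] [MeasurableSingletonClass G]
    [MeasurableSub G] [MeasurableNeg G] :
    IsPointStationaryLaw (Measure.dirac (Measure.count : Measure G) : Measure (Measure G)) := by
  have hae : ∀ᵐ μ ∂(Measure.dirac (Measure.count : Measure G) : Measure (Measure G)),
      μ = Measure.count := by
    rw [ae_iff]
    have h : {μ : Measure G | ¬μ = Measure.count} = {μ : Measure G | μ = Measure.count}ᶜ := rfl
    rw [h, Measure.dirac_apply' _ (measurableSet_setOf_eq_count (G := G)).compl]
    simp
  refine IsPointStationaryLaw.of_ae_invariant (hae.mono fun μ hμ => ?_)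
  subst hμ
  refine ⟨Filter.Eventually.of_forall fun y => ?_, ?_⟩
  · refine Measure.ext_of_singleton fun a => ?_
    rw [Measure.map_apply (measurable_sub_const y) (measurableSet_singleton a),
      Measure.count_singleton]
    have hpre : (fun z : G => z - y) ⁻¹' ({a} : Set G) = {a + y} := by
      ext z
      simp [sub_eq_iff_eq_add]
    rw [hpre, Measure.count_singleton]
  · refine Measure.ext_of_singleton fun a => ?_
    rw [Measure.map_apply measurable_neg (measurableSet_singleton a), Measure.count_singleton]
    have hpre : (fun z : G => -z) ⁻¹' ({a} : Set G) = {-a} := by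
      ext z
      simp
    rw [hpre, Measure.count_singleton]

end PointStationary

/-! ### Rooted hard-core configurations -/

section HardCore

variable {E : Type*} [PseudoMetricSpace E] [Zero E] [MeasurableSpace E]

/-- **Rooted `δ`-hard-core configuration**: `μ` is the counting measure `count.restrict S` of a
point set `S` that contains the root `0` and is `δ`-separated (distinct points are at distance
`≥ δ`). These are the configurations seen from a typical particle of a hard-sphere / minimal-
distance particle system (e.g. Lennard-Jones ground states, minimal distance `δ`). The separation
clause is `S.Pairwise (δ ≤ dist · ·)` (`isRootedHardCore_iff_pairwise`); no sign condition on
`δ` is imposed. [folklore] -/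
def IsRootedHardCore (δ : ℝ) (μ : Measure E) : Prop :=
  ∃ S : Set E, (0 : E) ∈ S ∧ (∀ x ∈ S, ∀ y ∈ S, x ≠ y → δ ≤ dist x y) ∧
    μ = (Measure.count : Measure E).restrict S

/-- `IsRootedHardCore` with the separation written as `Set.Pairwise`. [folklore] -/
theorem isRootedHardCore_iff_pairwise (δ : ℝ) (μ : Measure E) :
    IsRootedHardCore δ μ ↔ ∃ S : Set E, (0 : E) ∈ S ∧ S.Pairwise (fun x y => δ ≤ dist x y) ∧
      μ = (Measure.count : Measure E).restrict S :=
  Iff.rfl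

/-- A `δ`-hard-core configuration is `δ'`-hard-core for every `δ' ≤ δ`. [folklore] -/
theorem IsRootedHardCore.mono {δ δ' : ℝ} {μ : Measure E} (h : IsRootedHardCore δ μ)
    (hδ : δ' ≤ δ) : IsRootedHardCore δ' μ := by
  obtain ⟨S, h0, hsep, hμ⟩ := h
  exact ⟨S, h0, fun x hx y hy hxy => hδ.trans (hsep x hx y hy hxy), hμ⟩

/-- In a rooted hard-core configuration the root carries mass exactly `1`. [folklore] -/
theorem IsRootedHardCore.measure_zero_singleton [MeasurableSingletonClass E] {δ : ℝ}
    {μ : Measure E} (h : IsRootedHardCore δ μ) : μ {0} = 1 := by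
  obtain ⟨S, h0, -, rfl⟩ := h
  rw [Measure.restrict_apply (measurableSet_singleton 0),
    inter_eq_left.2 (singleton_subset_iff.2 h0), Measure.count_singleton]

/-- The configuration consisting of the root alone, `δ_0 = count.restrict {0}`, is a rooted
`δ`-hard-core configuration for every `δ`. [folklore] -/
theorem isRootedHardCore_dirac_zero [MeasurableSingletonClass E] (δ : ℝ) :
    IsRootedHardCore δ (Measure.dirac (0 : E)) := by
  refine ⟨{0}, mem_singleton 0, ?_, ?_⟩
  · intro x hx y hy hxy
    rw [mem_singleton_iff] at hx hy
    exact absurd (hx.trans hy.symm) hxy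
  · rw [Measure.restrict_singleton, Measure.count_singleton, one_smul]

end HardCore

/-! ### Re-rooting counting measures and hard-core configurations -/

section Reroot

variable {E : Type*} [MeasurableSpace E]

/-- For a counting measure `count|S`, `y` is a point (`count|S {y} ≠ 0`) iff `y ∈ S`.
[folklore] -/
theorem count_restrict_singleton_ne_zero_iff [MeasurableSingletonClass E] (S : Set E) (y : E) :
    (Measure.count : Measure E).restrict S {y} ≠ 0 ↔ y ∈ S := by
  rw [Measure.restrict_apply (measurableSet_singleton y)]
  by_cases hy : y ∈ S
  · rw [inter_eq_left.2 (singleton_subset_iff.2 hy), Measure.count_singleton]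
    simpa using hy
  · rw [singleton_inter_eq_empty.2 hy, measure_empty]
    simpa using hy

variable [AddGroup E]

/-- **Shift of a counting measure**: re-rooting the configuration `count|S` at `y` gives the
counting measure of the translated set, `(count|S).map (· - y) = count|(S - y)`. [folklore] -/
theorem map_sub_count_restrict [MeasurableSingletonClass E] [MeasurableAdd E] (S : Set E)
    (y : E) :
    ((Measure.count : Measure E).restrict S).map (fun z => z - y) =
      (Measure.count : Measure E).restrict ((fun z => z - y) '' S) := by
  ext s hs
  rw [(measurableEmbedding_subRight y).map_apply, Measure.restrict_apply hs,
    Measure.restrict_apply ((measurableEmbedding_subRight y).measurable hs),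
    ← image_preimage_inter (fun z => z - y) S s,
    Measure.count_injective_image sub_left_injective]

variable [PseudoMetricSpace E] [IsIsometricVAdd Eᵃᵒᵖ E]

/-- **Re-rooting preserves the hard core**: if `μ` is a rooted `δ`-hard-core configuration and
`y` is one of its points (`μ {y} ≠ 0`), then the configuration re-rooted at `y`,
`θ_y μ = μ.map (· - y)`, is again a rooted `δ`-hard-core configuration (translations are
isometries). This is the deterministic half of the "root ⇝ typical point" transfer under a
point-stationary law. [folklore] -/
theorem IsRootedHardCore.map_sub [MeasurableSingletonClass E] [MeasurableAdd E] {δ : ℝ}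
    {μ : Measure E} (h : IsRootedHardCore δ μ) {y : E} (hy : μ {y} ≠ 0) :
    IsRootedHardCore δ (μ.map (fun z => z - y)) := by
  obtain ⟨S, -, hsep, rfl⟩ := h
  have hyS : y ∈ S := (count_restrict_singleton_ne_zero_iff S y).1 hy
  refine ⟨(fun z => z - y) '' S, ⟨y, hyS, sub_self y⟩, ?_, map_sub_count_restrict S y⟩
  rintro _ ⟨x, hx, rfl⟩ _ ⟨x', hx', rfl⟩ hne
  rw [dist_sub_right]
  exact hsep x hx x' hx' fun hxx' => hne (by rw [hxx'])

end Reroot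

end Literature.Probability.Process
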